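import Literature.AlgebraicGeometry.Resolution.AlterationsModelExtension
import Literature.AlgebraicGeometry.Resolution.AlterationsStrictTransform
import Literature.AlgebraicGeometry.Resolution.AlterationsSemiStableResolution
import HarnessLib

/-!
# De Jong's alteration theorem: 4.18–4.21/4.22 as the three-point extension over a modification
# plus the strict transform 4.15 — the glue PROVED

Topic: `Literature/AlgebraicGeometry/Resolution`. Companion to `AlterationsModelExtension.lean`,
which vendors de Jong 1996, 4.18–4.21 with the first two sentences of 4.22 as ONE named fact
`DeJong1996ModelExtensionReduction`: Thm. 4.1 with its generically-étale clause for a fibred pair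
with (vi) e), f), g) follows from the same for all fibred pairs with (vi) e), f) and g) WITH `β`
EXTENDED of the same dimension. The printed text reaches the extended `β` in two moves — an
EXISTENCE statement about a modification of the base, and the base change 4.15:

> "4.21. […] We conclude that the properties a)–c), e) and g) on data `X → S`, `σᵢ` as in 4.18
> imply that the rational map `β` extends to a birational morphism `β : 𝒞 → X`, at least after
> replacing `S` by a modification and `𝒞` and `X` by their strict transforms.
> 4.22. […] We apply the results of 4.18–4.21 and find a modification `ψ : Y' → Y`, such that
> `β'` extends. Once again using 4.15 we may replace `Y` by `Y'`, etc., and assume that `β`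
> extends to `β : 𝒞 → X` and we still have (i)–(iv), (vi) a)–g)." (p. 74)

The base change 4.15 is the named fact `DeJong1996StrictTransform` (`AlterationsStrictTransform.lean`):
for a generically étale alteration `ψ : Y' → Y` from a projective variety, the strict transform
`X' = (Y' ×_Y X)_red` — delivered through its characterisation, a surjective closed immersion
`ι : X' → X ×_Y Y'` from a reduced scheme, with `f' = ι ≫ pr_{Y'}`, `φ = ι ≫ pr_X`,
`Z' = φ⁻¹(Z)` — is again a fibred pair with (vi) e), and `φ` is a generically étale alteration.
Accordingly this file

* vendors **4.18–4.21 with 4.22's "find a modification `ψ : Y' → Y`, such that `β'` extends"**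
  (and the remarks of 4.16/4.17 that (vi) f), g) pass to the strict transform) as the NAMED FACT
  `DeJong1996ThreePointExtension`: for a fibred pair with (vi) e), f), g) there is a projective
  modification `ψ : Y' → Y` such that every strict transform `(X', ι)` as in 4.15 carries
  (vi) f) + g) with `β` extended (`DeJong1996.IsUnionOfSectionsWithExtendedModel`), in the
  `∀ (X', ι)` form of `DeJong1996GaloisNormalization` (all such `(X', ι)` are canonically
  isomorphic to the reduction of `X ×_Y Y'`);
* PROVES the glue `DeJong1996ModelExtensionReduction.of_threePoint_of_strictTransform` ("As
  before it is clear that it suffices to prove the theorem for the pair `(X', Z')`": a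
  modification is a generically étale alteration, 2.17/2.20, so 4.15 applies; the strict
  transform pair is a fibred pair with (vi) e), f) and g)-extended of dimension `dim X`, 2.20;
  and 4.4 descends along `φ`, `DeJong1996.ConclusionGenericallyEtale.of_strictTransform`), with
  its composites down to `DeJong1996StableModelToPreSemiStablePair`,
  `DeJong1996SectionsToPreSemiStablePair` and `DeJong1996StrongAlgClosed`.

`DeJong1996ThreePointExtension` is the node to decompose further: the closure `T` of the graph
of `β`, flattening of `X` and `T` by a projective modification (2.19, `DeJong1996Flattening` of
`StrictTransform.lean`, where the strict transform of 2.18 is constructed as a scheme),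
normalisation of the base, the three-point Lemma 4.20, Serre's criterion for `𝒞` (4.21), and the
transport of (vi) f), g) to the strict transform (proved for (vi) f) + g) in
`AlterationsStrictTransformModel.lean`).

## Sources

* A. J. de Jong, *Smoothness, semi-stability and alterations*, Publ. Math. IHÉS 83 (1996) 51–93:
  2.17–2.20 (pp. 59–61), 4.4 (p. 66), 4.15–4.17 (pp. 71–72), 4.18–4.22 (pp. 72–74).
-/

noncomputable section

open CategoryTheory CategoryTheory.Limits AlgebraicGeometry TopologicalSpace Topology

namespace Literature.AlgebraicGeometry.Resolution

universe u

/-! ## 4.18–4.21/4.22 as a named fact -/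

/-- NAMED FACT — **de Jong 1996, 4.18–4.21 with 4.22, "find a modification `ψ : Y' → Y`, such
that `β'` extends".** Over an algebraically closed field `k`, let `(X, Z)` with
`f : X → Y → Spec k` satisfy (i), (iii), (iv), (vi) a)–d) (`DeJong1996.FibredPair f g Z`), (vi) e)
(`DeJong1996.HasThreeSmoothPoints f Z`) and (vi) f) + g) (`DeJong1996.IsUnionOfSectionsWithModel
f g Z`: `Z = ⋃ σᵢ(Y)` and a pointed semi-stable model `(p : 𝒞 → Y, τ)` with an isomorphism
`β : 𝒞_U ⥲ X_U` matching the sections). Then there is a modification `ψ : Y' → Y`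
(`IsModification`: `Y'` integral, `ψ` proper birational) with `Y'` projective over `k`, such
that for every strict transform `(X', ι : X' → X ×_Y Y')` as in 4.15 (`ι` a surjective closed
immersion from a reduced scheme; `f' = ι ≫ pr_{Y'}`, `φ = ι ≫ pr_X`) the pair
`(X' → Y', Z' = φ⁻¹(Z))` has (vi) f) + g) WITH `β` EXTENDED
(`DeJong1996.IsUnionOfSectionsWithExtendedModel`): "4.18. We want to prove that the rational map
`β` extends to a morphism of `𝒞` into `X`, perhaps after replacing `Y` by a modification. […]
Let us define `T` as the closure of `Γ_β` in the scheme `𝒞 ×_S X`. […] Let `S' → S` be a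
modification and apply the reasoning of 4.15. This gives a new set of data `X'`, `σ'ᵢ`, `𝒞'`,
`τ'ᵢ`, `β'` over the scheme `S'` satisfying the properties a)–c), e) and g). We remark that `X'`
is the strict transform of `X`, see 2.18. […] by [22], see 2.19, we may assume […] h) Both `X`
and `T` […] are flat over `S`. […] i) The scheme `S` is normal. 4.19. […] 4.20. Lemma. […]
4.21. […] the lemma implies that the morphism `pr₁ : T → 𝒞` has finite fibres, hence is a
finite morphism. […] `𝒞` is a normal scheme […]. Thus the birational finite morphism
`pr₁ : T → 𝒞` is an isomorphism. We conclude that […] the rational map `β` extends to a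
birational morphism `β : 𝒞 → X`, at least after replacing `S` by a modification and `𝒞` and
`X` by their strict transforms. 4.22. […] We apply the results of 4.18–4.21 and find a
modification `ψ : Y' → Y`, such that `β'` extends." The modifications used (2.19: a closed
subscheme of a Hilbert scheme, projective over `Y`; the normalisation, finite) are projective,
so `Y'` is projective over `k`; (vi) f) and g) pass to the strict transform ("(vi) f) is also
preserved by alterations as in 4.15", 4.16; "(vi) g) is preserved by operations as in 4.15, by
putting `𝒞' = 𝒞 ×_Y Y'`, etc.", 4.17), the open `U` being shrunk into `ψ⁻¹` of the locus over
which `f` is smooth (non-empty by (vi) c)); every `(X', ι)` as quantified is canonically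
isomorphic to the reduction of `X ×_Y Y'`, which here is the strict transform of 2.18 (by
(vi) b) `f` is flat at the generic points of the components of all fibres). Of "stable
`n`-pointed" only nodality, the distinctness of the labelled points and their lying in the
smooth locus are used (4.20, 4.21). Users take `(h : DeJong1996ThreePointExtension)`; it is the
node to decompose further (`DeJong1996Flattening`, Lemma 4.20, Serre's criterion).
[cite: DeJong1996, 4.18–4.22, pp. 72–74] -/
def DeJong1996ThreePointExtension : Prop :=
  ∀ (k : Type u) [Field k] [IsAlgClosed k] (X Y : Scheme.{u}) [IsIntegral Y] (f : X ⟶ Y)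
    [LocallyOfFinitePresentation f] (g : Y ⟶ Spec (.of k)) (Z : Set X),
    DeJong1996.FibredPair f g Z → DeJong1996.HasThreeSmoothPoints f Z →
      DeJong1996.IsUnionOfSectionsWithModel f g Z →
        ∃ (Y' : Scheme.{u}) (_ : IsIntegral Y') (ψ : Y' ⟶ Y),
          Literature.AlgebraicGeometry.Motives.IsProjectiveOver (Over.mk (ψ ≫ g)) ∧
            IsModification ψ ∧
              ∀ (X' : Scheme.{u}) (ι : X' ⟶ pullback f ψ) [IsClosedImmersion ι] [Surjective ι]
                [IsReduced X'],
                DeJong1996.IsUnionOfSectionsWithExtendedModel (ι ≫ pullback.snd f ψ) (ψ ≫ g)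
                  ((ι ≫ pullback.fst f ψ) ⁻¹' Z)

/-! ## The glue -/

/-- **`DeJong1996ModelExtensionReduction` (4.18–4.21 with the first sentences of 4.22) from the
three-point extension and the strict transform 4.15.** Given a fibred pair with (vi) e), f), g):
`DeJong1996ThreePointExtension` provides the projective modification `ψ : Y' → Y`; a modification
is a generically étale alteration (2.17/2.20, `IsModification.isAlteration`,
`IsModification.isGenericallyEtale`), so 4.15 (`DeJong1996StrictTransform`) provides the strict
transform `(X', ι)` — a fibred pair with (vi) e), `φ` a generically étale alteration — on which
`β'` extends; `dim X' = dim X` (2.20, `IsAlteration.topologicalKrullDim_eq`), so the hypothesis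
applies to `(X', Z')`, and 4.4 along `φ` descends the conclusion
(`DeJong1996.ConclusionGenericallyEtale.of_strictTransform`): "Once again using 4.15 we may
replace `Y` by `Y'`, etc." [cite: DeJong1996, 4.15 and 4.22, pp. 71, 74] -/
theorem DeJong1996ModelExtensionReduction.of_threePoint_of_strictTransform
    (hA : DeJong1996ThreePointExtension.{u}) (h415 : DeJong1996StrictTransform.{u}) :
    DeJong1996ModelExtensionReduction.{u} := by
  intro k _ _ X Y _ f _ g Z hP h3 hfg H
  obtain ⟨Y', hY', ψ, hproj, hmod, hext⟩ := hA k X Y f g Z hP h3 hfg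
  haveI := hY'
  obtain ⟨X', ι, hι, hιs, hred, hlofp, hP', h3', hφ, hφe⟩ :=
    h415 k X Y Y' f g Z ψ hP h3 hmod.isAlteration hmod.isGenericallyEtale hproj
  haveI := hι
  haveI := hιs
  haveI := hred
  haveI := hlofp
  haveI := hP.isIntegral
  haveI : LocallyOfFiniteType (f ≫ g) := hP.locallyOfFiniteType
  refine DeJong1996.ConclusionGenericallyEtale.of_strictTransform f g ψ Z ι hφ hφe ?_
  exact H X' Y' (ι ≫ pullback.snd f ψ) (ψ ≫ g) ((ι ≫ pullback.fst f ψ) ⁻¹' Z) hP' h3'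
    (hext X' ι) (hφ.topologicalKrullDim_eq (f ≫ g))

/-- **4.18–4.22a (`DeJong1996StableModelToPreSemiStablePair`) from the three-point extension, the
strict transform 4.15 and the proved 4.22a.** [cite: DeJong1996, 4.15 and 4.18–4.22, pp. 71–74] -/
theorem DeJong1996StableModelToPreSemiStablePair.of_threePoint_of_strictTransform
    (hA : DeJong1996ThreePointExtension.{u}) (h415 : DeJong1996StrictTransform.{u}) :
    DeJong1996StableModelToPreSemiStablePair.{u} :=
  DeJong1996StableModelToPreSemiStablePair.of_extensionReduction
    (DeJong1996ModelExtensionReduction.of_threePoint_of_strictTransform hA h415)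

/-- **4.17–4.22a (`DeJong1996SectionsToPreSemiStablePair`) from 4.17
(`DeJong1996StableModelReduction`), the three-point extension and the strict transform 4.15.**
[cite: DeJong1996, 4.15–4.22, pp. 71–74] -/
theorem DeJong1996SectionsToPreSemiStablePair.of_stableModel_of_threePoint_of_strictTransform
    (h₁ : DeJong1996StableModelReduction.{u}) (hA : DeJong1996ThreePointExtension.{u})
    (h415 : DeJong1996StrictTransform.{u}) : DeJong1996SectionsToPreSemiStablePair.{u} :=
  DeJong1996SectionsToPreSemiStablePair.of_stableModel_of_extensionReduction h₁
    (DeJong1996ModelExtensionReduction.of_threePoint_of_strictTransform hA h415)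

/-- **4.15–4.22a (`DeJong1996MultisectionToPreSemiStablePair`) from the strict transform 4.15, the
Galois normalisation 4.16, 4.17 and the three-point extension** — 4.15 serving both 4.16 and
4.22. [cite: DeJong1996, 4.15–4.22, pp. 71–74] -/
theorem DeJong1996MultisectionToPreSemiStablePair.of_strictTransform_of_galoisNormalization_of_stableModel_of_threePoint
    (h415 : DeJong1996StrictTransform.{u}) (h416 : DeJong1996GaloisNormalization.{u})
    (h₁ : DeJong1996StableModelReduction.{u}) (hA : DeJong1996ThreePointExtension.{u}) :
    DeJong1996MultisectionToPreSemiStablePair.{u} :=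
  DeJong1996MultisectionToPreSemiStablePair.of_strictTransform_of_galoisNormalization_of_toPre
    h415 h416
    (DeJong1996SectionsToPreSemiStablePair.of_stableModel_of_threePoint_of_strictTransform h₁ hA
      h415)

/-- **Thm. 4.1 with its generically-étale clause over algebraically closed fields
(`DeJong1996StrongAlgClosed`) from the eight live nodes** 4.11–4.12, 4.14, 4.15 (strict
transform), 4.16 (Galois normalisation), 4.17, 4.18–4.21/4.22 (three-point extension), 4.22b,
4.23–4.28. [cite: DeJong1996, 4.3–4.28, pp. 66–76] -/
theorem DeJong1996StrongAlgClosed.of_eightBlocks (h₀ : DeJong1996FibrationReduction.{u})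
    (h14 : DeJong1996MultisectionReduction.{u}) (h415 : DeJong1996StrictTransform.{u})
    (h416 : DeJong1996GaloisNormalization.{u}) (h₁ : DeJong1996StableModelReduction.{u})
    (hA : DeJong1996ThreePointExtension.{u}) (h₃ : DeJong1996PreSemiStablePairToSemiStablePair.{u})
    (hres : DeJong1996SemiStablePairResolution.{u}) : DeJong1996StrongAlgClosed.{u} :=
  DeJong1996StrongAlgClosed.of_sevenBlocks' h₀ h14
    (DeJong1996SectionsReduction.of_strictTransform_of_galoisNormalization h415 h416) h₁
    (DeJong1996ModelExtensionReduction.of_threePoint_of_strictTransform hA h415) h₃ hres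

/-- Thm. 4.1 (i)+(ii) over every field from 4.5 (`DeJong1996Descent`) and the eight live nodes.
[cite: DeJong1996, 4.3–4.28, pp. 66–76] -/
theorem DeJong1996Strong.of_descent_of_eightBlocks (h45 : DeJong1996Descent.{u})
    (h₀ : DeJong1996FibrationReduction.{u}) (h14 : DeJong1996MultisectionReduction.{u})
    (h415 : DeJong1996StrictTransform.{u}) (h416 : DeJong1996GaloisNormalization.{u})
    (h₁ : DeJong1996StableModelReduction.{u}) (hA : DeJong1996ThreePointExtension.{u})
    (h₃ : DeJong1996PreSemiStablePairToSemiStablePair.{u})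
    (hres : DeJong1996SemiStablePairResolution.{u}) : DeJong1996Strong.{u} :=
  DeJong1996Strong.of_descent_of_sevenBlocks' h45 h₀ h14
    (DeJong1996SectionsReduction.of_strictTransform_of_galoisNormalization h415 h416) h₁
    (DeJong1996ModelExtensionReduction.of_threePoint_of_strictTransform hA h415) h₃ hres

end Literature.AlgebraicGeometry.Resolution

end
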